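import Literature.Algebra.InverseSystem.AddInverseLimit
import Mathlib.NumberTheory.Padics.RingHoms
import HarnessLib

/-!
# Route `ThetaPartnerAtTwo` (TP2), crux K3 `SignedKatoDivisibilityUpToAtTwo` (item stmt-BirchSwinnertonDyer-20308),
# line `colemanrat` v6 — the `k`-GLUE of the definition item (D-layer): a `ℤ_p`-valued, `ℤ_p`-linear layer pairing from a
# COMPATIBLE FAMILY of `ℤ/p^k`-valued bi-additive pairings (generic inverse-limit algebra; no elliptic curve)

Width seat `bsd-wall-tp2-p2x-w2` g3 (cell `bsd-wall`). HONEST FRAMING: THEOREMS ONLY — no definition, no named fact, no instance, no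
`sorry`; Mathlib + the tree's `Literature/Algebra/InverseSystem/AddInverseLimit.lean` only (`ℤ_p ≃+ lim ℤ/p^m`); closes no item; BSD is
NOT proved by any of this. Intended home once a typer wants it: `Literature/Algebra/InverseSystem/` (nothing here is specific to K3).

## Why this file

The research residue of K3 read at finite level (`…H1SideOfLayerPairings.lean`, memo `Cruxes/…/W2G3-LAYER-RESIDUE.md`) starts with
the definition item (D-layer): per layer `n` a `ℤ_p`-LINEAR pairing `pair n : H¹(ℚ_n, T_pW) →ₗ[ℤ_p] Hom(E(ℚ_n·ℚ_v), ℤ_p)`. What the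
tree can build directly are the FINITE-COEFFICIENT pairings `H¹(ℚ_n, T) × E(ℚ_n·ℚ_v) → ℤ/p^k`
(`x, Q ↦ inv_v(cor(res (x mod p^k) ∪_Weil δ_k Q))`: `Kato2004.reduceH1Pk`, `ContPairing.cupProduct`, `localInvariantMap`), compatible under
`ℤ/p^{k+1} → ℤ/p^k`. This file is the passage from such a family to the `ℤ_p`-valued, `ℤ_p`-linear pairing, with its residue formula
and uniqueness — so (D-layer) reduces to a family `pk n k` of bi-additive `ℤ/p^k`-valued pairings, `ℤ_p`-semilinear in the class,
compatible in `k` (and (P1), (P2) may be checked residue-wise: `eq_of_forall_toZModPow_eq`).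

## What is proved (`H` a `ℤ_p`-module, `A` an abelian group, `pk k : H →+ (A →+ ZMod (p^k))`)
* `exists_addMonoidHom_padicInt_of_compatible` — one variable: a compatible family `f k : A →+ ℤ/p^k` glues to `F : A →+ ℤ_p` with
  `toZModPow k (F a) = f k a` (`addInverseLimit.lift` + `padicIntAddEquiv`).
* **`exists_linear_pairing_of_compatible`** — two variables: from `pk` compatible in `k` and `ℤ_p`-semilinear in the first variable
  (`pk k (c • x) a = (c mod p^k) · pk k x a`), a `ℤ_p`-LINEAR `pair : H →ₗ[ℤ_p] (A →+ ℤ_p)` with `toZModPow k (pair x a) = pk k x a`.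
* `eq_of_forall_toZModPow_eq` — uniqueness / residue-wise equality of values (Mathlib `PadicInt.ext_of_toZModPow`).

References: [Milne2025, Ch. V §1] (`ℤ_l = lim ℤ/lⁿ`); [Kato2004Asterisque] §13.8 (change of coefficients `T → T/p^k`);
[PerrinRiou1994Invent] §3.6.1 (the `Λ`-adic pairing as a limit of finite-level pairings).
-/

set_option autoImplicit false
-- the Theorems namespace of this sub repeats the summit name by design (D-0017 nested layout)
set_option linter.dupNamespace false

noncomputable section

namespace Summit.BirchSwinnertonDyer.BirchSwinnertonDyer.Theorems

namespace SignedKatoOffTwo.LayerPairingLimit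

open Literature.Algebra.InverseSystem

variable {p : ℕ} [Fact p.Prime] {H : Type*} {A : Type*} [AddCommGroup H] [Module ℤ_[p] H] [AddCommGroup A]

/-- Two `p`-adic integers with the same residues modulo every `p^k` are equal (Mathlib `PadicInt.ext_of_toZModPow`), in the form
used to transfer identities ((P1), (P2), …) from the finite-coefficient pairings to the glued one. [cite: Milne2025, Ch. V §1] -/
theorem eq_of_forall_toZModPow_eq {a b : ℤ_[p]} (h : ∀ k : ℕ, PadicInt.toZModPow k a = PadicInt.toZModPow k b) : a = b :=
  PadicInt.ext_of_toZModPow.1 h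

/-- **One variable: a compatible family `f k : A →+ ℤ/p^k` glues to `F : A →+ ℤ_p`** with `F a mod p^k = f k a`
(`ℤ_p = lim ℤ/p^k`: the tree's `padicIntAddEquiv` and `addInverseLimit.lift`). [cite: Milne2025, Ch. V §1] -/
theorem exists_addMonoidHom_padicInt_of_compatible (f : ∀ k : ℕ, A →+ ZMod (p ^ k))
    (hf : ∀ (k : ℕ) (a : A), (ZMod.cast (f (k + 1) a) : ZMod (p ^ k)) = f k a) :
    ∃ F : A →+ ℤ_[p], ∀ (k : ℕ) (a : A), PadicInt.toZModPow k (F a) = f k a := by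
  have hφ : ∀ (m : ℕ) (a : A), zmodPowTransition p m (f (m + 1) a) = f m a := fun m a ↦ by
    rw [zmodPowTransition_apply, hf]
  refine ⟨(padicIntAddEquiv p).symm.toAddMonoidHom.comp
      (addInverseLimit.lift (G := fun m ↦ ZMod (p ^ m)) (zmodPowTransition p) f hφ), fun k a ↦ ?_⟩
  rw [AddMonoidHom.comp_apply, AddEquiv.coe_toAddMonoidHom, ← proj_padicIntAddEquiv p k,
    AddEquiv.apply_symm_apply, addInverseLimit.proj_lift]

/-- **Two variables: a `ℤ_p`-LINEAR, `ℤ_p`-valued pairing from a compatible family of `ℤ/p^k`-valued bi-additive pairings.** Given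
`pk k : H →+ (A →+ ℤ/p^k)` (bi-additive), compatible under `ℤ/p^{k+1} → ℤ/p^k`, and `ℤ_p`-semilinear in the first variable
(`pk k (c • x) a = (c mod p^k) · pk k x a`), there is `pair : H →ₗ[ℤ_p] (A →+ ℤ_p)` with `pair x a mod p^k = pk k x a` for all `k`
(unique by `eq_of_forall_toZModPow_eq`). This is the passage from the finite-coefficient local Tate pairings
`inv(res(x mod p^k) ∪ δ_k Q)` to the `T_pE`-adic layer pairing of the definition item (D-layer).
[cite: Kato2004Asterisque, §13.8 (pp. 228–229)] [cite: PerrinRiou1994Invent, §3.6.1] [cite: Milne2025, Ch. V §1] -/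
theorem exists_linear_pairing_of_compatible (pk : ∀ k : ℕ, H →+ (A →+ ZMod (p ^ k)))
    (hcompat : ∀ (k : ℕ) (x : H) (a : A), (ZMod.cast (pk (k + 1) x a) : ZMod (p ^ k)) = pk k x a)
    (hlin : ∀ (k : ℕ) (c : ℤ_[p]) (x : H) (a : A), pk k (c • x) a = PadicInt.toZModPow k c * pk k x a) :
    ∃ pair : H →ₗ[ℤ_[p]] (A →+ ℤ_[p]), ∀ (k : ℕ) (x : H) (a : A), PadicInt.toZModPow k (pair x a) = pk k x a := by
  -- glue in the second variable for each fixed `x`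
  have hx : ∀ x : H, ∃ F : A →+ ℤ_[p], ∀ (k : ℕ) (a : A), PadicInt.toZModPow k (F a) = pk k x a := fun x ↦
    exists_addMonoidHom_padicInt_of_compatible (fun k ↦ pk k x) fun k a ↦ hcompat k x a
  choose F hF using hx
  refine ⟨{ toFun := F
            map_add' := fun x y ↦ AddMonoidHom.ext fun a ↦ eq_of_forall_toZModPow_eq fun k ↦ ?_
            map_smul' := fun c x ↦ AddMonoidHom.ext fun a ↦ eq_of_forall_toZModPow_eq fun k ↦ ?_ }, fun k x a ↦ hF x k a⟩
  · rw [AddMonoidHom.add_apply, map_add, hF, hF, hF, map_add, AddMonoidHom.add_apply]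
  · rw [RingHom.id_apply, AddMonoidHom.smul_apply, smul_eq_mul, map_mul, hF, hF, hlin]

/-- **Residue-wise transfer of identities**: two values of glued pairings agree as soon as their residues agree at every level —
e.g. the projection formula (P1) or the Galois invariance (P2) of the glued layer pairing follows from the same identity for each
finite-coefficient pairing `pk k`. [cite: Milne2025, Ch. V §1] -/
theorem apply_eq_apply_of_forall_residue {pair pair' : H →ₗ[ℤ_[p]] (A →+ ℤ_[p])}
    {pk pk' : ∀ k : ℕ, H →+ (A →+ ZMod (p ^ k))}
    (hpair : ∀ (k : ℕ) (x : H) (a : A), PadicInt.toZModPow k (pair x a) = pk k x a)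
    (hpair' : ∀ (k : ℕ) (x : H) (a : A), PadicInt.toZModPow k (pair' x a) = pk' k x a)
    {x x' : H} {a a' : A} (h : ∀ k : ℕ, pk k x a = pk' k x' a') :
    pair x a = pair' x' a' :=
  eq_of_forall_toZModPow_eq fun k ↦ by rw [hpair, hpair', h]

end SignedKatoOffTwo.LayerPairingLimit

end Summit.BirchSwinnertonDyer.BirchSwinnertonDyer.Theorems

end
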